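import Literature.AlgebraicGeometry.Motives.HyperbolicWeilTypeProduct
import Literature.AlgebraicGeometry.Motives.SegreHyperplaneClass
import Literature.AlgebraicGeometry.Motives.PolarizationPairingProduct
import Literature.AlgebraicGeometry.Motives.AbelianVarietyProductDimProofs
import Literature.AlgebraicGeometry.Motives.AbelianVarietyCohomologyExteriorH1
import Literature.AlgebraicGeometry.HodgeTheory.AbelianVarietyEndomorphismsHOne
import Literature.AlgebraicGeometry.HodgeTheory.WeilClassesIsogenyDescent
import HarnessLib

/-!
# The tensor surface `(E × E, companion)` is of hyperbolic Weil type (stub `stub_tensorSurfaceHyperbolic` of crux `HyperbolicEightfoldsSqrtMinus7`)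

Route `HeckePrymWeil` (sub-problem `HodgeConjecture`), crux `HyperbolicEightfoldsSqrtMinus7`
(stmt-HodgeConjecture-14642), line `Sketch`, skeleton v9 ("hyperbolic reach"), registered stub
`stub_tensorSurfaceHyperbolic`, proved by the line lead.

For any complex elliptic curve `E` (abelian variety of dimension `1`), any closed immersion
`f₀ : E ↪ ℙᴹ`, any `d ≥ 1` and any Segre-additive family `g` of hyperplane classes, the "tensor surface"
`(E × E, ψ)`, `ψ = prodLift (snd ≫ (-[d])) fst : (x, y) ↦ (-d·y, x)` (the companion `√-d` of
`E ⊗ ℤ[√-d]`), is of HYPERBOLIC Weil type (`Motives.IsHyperbolicWeilType`) in half-dimension `1` for the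
`K`-symmetrised class `d·θ + ψ^*θ` of the Segre hyperplane class `θ = ((f₀ ⊗ f₀) ≫ σ_{M,M})^* g`.
Proof: `θ = pr₁^*θ₀ + pr₂^*θ₀` (`θ₀ = f₀^* g_M`; Segre additivity and naturality), `ψ^* pr₁^* = pr₂^* ∘ (-[d])^*`,
`ψ^* pr₂^* = pr₁^*`, `(-[d])^* = d²` on `H²`, so the class is `pr₁^*((d+1)θ₀) + pr₂^*((d+d²)θ₀)`; the frame
is `pr₁^*ℓ, pr₂^*ℓ` for a non-zero rational `ℓ ∈ H¹(E)` — rational, `ℂ`-independent (Künneth in degree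
one), `ψ^*`-stable (`ψ^* pr₁^*ℓ = -d·pr₂^*ℓ`, `ψ^* pr₂^*ℓ = pr₁^*ℓ`), and Lagrangian: the diagonal blocks of
the Gram matrix are multiples of `ℓ ⌣ ℓ = 0` (graded commutativity), the mixed blocks vanish by parity of
degrees (`Motives/PolarizationPairingProduct`). This is the hyperbolicity of the tensor point `B ⊗ 𝒪_K` for
`B` a curve ([vanGeemen1994HodgeAV, 5.2–5.4]: `L ⊗ K` is Lagrangian for `L ⊂ H¹(B, ℚ)` Lagrangian).
No `sorry`, no new definition.
-/

noncomputable section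

set_option linter.dupNamespace false

open CategoryTheory MonoidalCategory CartesianMonoidalCategory AlgebraicGeometry
open Literature.AlgebraicGeometry Literature.AlgebraicGeometry.Motives
  Literature.AlgebraicGeometry.HodgeTheory Literature.AlgebraicTopology.SingularHomology
open Literature.AlgebraicGeometry.Motives.SegreHyperplaneClass

namespace Summit.HodgeConjecture.HodgeConjecture.Theorems.HyperbolicEightfoldsSqrtMinus7.HyperbolicReach

/-! ### The companion on pulled-back classes -/

/-- **`ψ^* pr₁^* x = pr₂^* (-[d])^* x`** for the companion `ψ = ((snd ≫ (-[d])), fst)` of `E × E`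
(`ψ ≫ fst = snd ≫ (-[d])`). [cite: Deligne1982HodgeCycles, Lemma 4.5] -/
theorem map_companion_map_fst (E : AbelianVariety ℂ) (d : ℕ) (k : ℕ) (x : complexBetti E.X k) :
    complexBetti.map (AbelianVariety.prodLift (AbelianVariety.snd E E ≫ (-((d : ℤ) • 𝟙 E)))
        (AbelianVariety.fst E E)).hom.hom.hom k (complexBetti.map (AbelianVariety.fst E E).hom.hom.hom k x) =
      complexBetti.map (AbelianVariety.snd E E).hom.hom.hom k
        (complexBetti.map (-((d : ℤ) • 𝟙 E)).hom.hom.hom k x) := by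
  change singularCohomology.map ℂ ℂ _ k (singularCohomology.map ℂ ℂ _ k x) =
    singularCohomology.map ℂ ℂ _ k (singularCohomology.map ℂ ℂ _ k x)
  rw [abelianVarietyHom_map_map_apply, abelianVarietyHom_map_map_apply, AbelianVariety.prodLift_fst]

/-- **`ψ^* pr₂^* x = pr₁^* x`** for the companion `ψ` of `E × E` (`ψ ≫ snd = fst`). [cite: Deligne1982HodgeCycles, Lemma 4.5] -/
theorem map_companion_map_snd (E : AbelianVariety ℂ) (d : ℕ) (k : ℕ) (x : complexBetti E.X k) :
    complexBetti.map (AbelianVariety.prodLift (AbelianVariety.snd E E ≫ (-((d : ℤ) • 𝟙 E)))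
        (AbelianVariety.fst E E)).hom.hom.hom k (complexBetti.map (AbelianVariety.snd E E).hom.hom.hom k x) =
      complexBetti.map (AbelianVariety.fst E E).hom.hom.hom k x := by
  change singularCohomology.map ℂ ℂ _ k (singularCohomology.map ℂ ℂ _ k x) = singularCohomology.map ℂ ℂ _ k x
  rw [abelianVarietyHom_map_map_apply, AbelianVariety.prodLift_snd]

/-- **`(-[d])^* = -d` on `H¹`** (additivity of `f ↦ f^*|_{H¹}`). [cite: LangeBirkenhake1992, §1.1 (p. 19)] -/
theorem map_neg_zsmul_id_one (E : AbelianVariety ℂ) (d : ℕ) (c : complexBetti E.X 1) :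
    complexBetti.map (-((d : ℤ) • 𝟙 E)).hom.hom.hom 1 c = (-(d : ℂ)) • c := by
  have h : (-((d : ℤ) • 𝟙 E) : E ⟶ E) = (-(d : ℤ)) • 𝟙 E + (0 : ℤ) • 𝟙 E := by
    rw [zero_smul, add_zero, neg_smul]
  rw [h, complexBetti_map_zsmul_id_add_zsmul_one]
  simp

/-- **`(-[d])^* = d²` on `H²`**, in the `ℤ`-scalar spelling (the tree's `complexBetti_map_neg_nsmul_id_two`).
[cite: MumfordAV1970, §1 (3)] -/
theorem map_neg_zsmul_id_two (E : AbelianVariety ℂ) (d : ℕ) (y : complexBetti E.X 2) :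
    complexBetti.map (-((d : ℤ) • 𝟙 E)).hom.hom.hom 2 y = ((d : ℂ) ^ 2) • y := by
  rw [natCast_zsmul]
  exact complexBetti_map_neg_nsmul_id_two E d y

/-- **The cup square of a degree-one class vanishes** (graded commutativity, characteristic `0`).
[cite: HatcherAT2002, §3.2 Thm. 3.11] -/
theorem cupProduct_self_one {X : SchemeOver ℂ} (ℓ : complexBetti X 1) :
    cupProduct (rfl : 1 + 1 = 2) ℓ ℓ = 0 := by
  have h := cupProduct_gradedComm_holds (R := ℂ) (X := Motives.ComplexPoints X) (rfl : 1 + 1 = 2) rfl ℓ ℓ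
  norm_num at h
  have h2 : (2 : ℂ) • cupProduct (rfl : 1 + 1 = 2) ℓ ℓ = 0 := by
    rw [two_smul]
    nth_rewrite 2 [h]
    exact add_neg_cancel _
  exact (smul_eq_zero.1 h2).resolve_left two_ne_zero

/-- A non-zero RATIONAL class exists in `H¹` of an elliptic curve (`dim H¹ = 2`, rational classes span).
[cite: MumfordAV1970, §1 (3)] -/
theorem exists_isRationalClass_ne_zero_one (E : AbelianVariety ℂ) (hE : E.dim = 1) :
    ∃ ℓ : complexBetti E.X 1, IsRationalClass ℓ ∧ ℓ ≠ 0 := by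
  have hX1 : Motives.IsSmoothProjective 1 E.X := isSmoothProjective_of_dim_eq' hE
  by_contra h
  push Not at h
  have htop := span_isRationalClass_eq_top_of_isSmoothProjective_holds 1 E.X hX1 1
  have hbot : Submodule.span ℂ {c : complexBetti E.X 1 | IsRationalClass c} = ⊥ :=
    Submodule.span_eq_bot.2 fun c hc ↦ h c hc
  have h2 : Module.finrank ℂ (complexBetti E.X 1) = 2 * E.dim := AbelianVariety.finrank_complexBetti_one (A := E)
  rw [hbot] at htop
  have h0 : Module.finrank ℂ (complexBetti E.X 1) = 0 := by
    rw [← finrank_top ℂ (complexBetti E.X 1), ← htop, finrank_bot]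
  omega

/-! ### The stub -/

/-- **Stub `stub_tensorSurfaceHyperbolic` of skeleton v9 of crux `HyperbolicEightfoldsSqrtMinus7` — the
tensor surface `(E × E, companion √-d)` is of HYPERBOLIC Weil type for the `K`-symmetrised hyperplane class
of the Segre embedding `(f₀ ⊗ f₀) ≫ σ_{M,M}`.**  Frame `pr₁^*ℓ, pr₂^*ℓ` for a non-zero rational `ℓ ∈ H¹(E)`;
rational; `ℂ`-independent by Künneth in degree one; `ψ^*`-stable since `ψ^* pr₁^*ℓ = -d·pr₂^*ℓ` and
`ψ^* pr₂^*ℓ = pr₁^*ℓ`; Lagrangian since the class is `pr₁^*((d+1)θ₀) + pr₂^*((d+d²)θ₀)` and the Gram matrix of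
such a class is block-diagonal (`Motives/PolarizationPairingProduct`) with diagonal blocks multiples of
`ℓ ⌣ ℓ = 0`. [cite: vanGeemen1994HodgeAV, Lemma 5.2 (2)–(3) and 5.4] [cite: HatcherAT2002, §3.2 Thm. 3.16]
[cite: Hartshorne1977, II Ex. 5.11 and Ex. 5.12] -/
theorem stub_tensorSurfaceHyperbolic :
    ∀ (g : (N : ℕ) → complexBetti (projectiveSpace N ℂ) 2),
      (∀ n m : ℕ, complexBetti.map (segreEmbedding n m ℂ) 2 (g (n * m + n + m)) =
        complexBetti.map (fst (projectiveSpace n ℂ) (projectiveSpace m ℂ)) 2 (g n) +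
          complexBetti.map (snd (projectiveSpace n ℂ) (projectiveSpace m ℂ)) 2 (g m)) →
    ∀ (E : AbelianVariety ℂ), E.dim = 1 → ∀ (M : ℕ) (f₀ : E.X ⟶ projectiveSpace M ℂ),
      IsClosedImmersion f₀.left → ∀ (d : ℕ), 0 < d →
      IsHyperbolicWeilType (E.prod E)
        (AbelianVariety.prodLift (AbelianVariety.snd E E ≫ (-((d : ℤ) • 𝟙 E))) (AbelianVariety.fst E E)) 1
        ((d : ℂ) • complexBetti.map ((f₀ ⊗ₘ f₀) ≫ segreEmbedding M M ℂ : (E.prod E).X ⟶ _) 2 (g (M * M + M + M)) +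
          complexBetti.map
            (AbelianVariety.prodLift (AbelianVariety.snd E E ≫ (-((d : ℤ) • 𝟙 E))) (AbelianVariety.fst E E)).hom.hom.hom 2
            (complexBetti.map ((f₀ ⊗ₘ f₀) ≫ segreEmbedding M M ℂ : (E.prod E).X ⟶ _) 2 (g (M * M + M + M)))) := by
  intro g hgσ E hE M f₀ _ d _
  classical
  -- notation
  set f := (AbelianVariety.fst E E).hom.hom.hom with hf
  set gm := (AbelianVariety.snd E E).hom.hom.hom with hgm
  set θ₀ : complexBetti E.X 2 := complexBetti.map f₀ 2 (g M) with hθ₀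
  have hX : Motives.IsSmoothProjective (0 + 1) E.X := isSmoothProjective_of_dim_eq' (by rw [hE])
  -- the hyperplane class of the Segre embedding: `pr₁^* θ₀ + pr₂^* θ₀`
  have hθ : complexBetti.map ((f₀ ⊗ₘ f₀) ≫ segreEmbedding M M ℂ : (E.prod E).X ⟶ _) 2 (g (M * M + M + M)) =
      complexBetti.map f 2 θ₀ + complexBetti.map gm 2 θ₀ := by
    change complexBetti.map ((f₀ ⊗ₘ f₀) ≫ segreEmbedding M M ℂ : E.X ⊗ E.X ⟶ _) 2 (g (M * M + M + M)) =
      complexBetti.map (fst E.X E.X) 2 (complexBetti.map f₀ 2 (g M)) +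
        complexBetti.map (snd E.X E.X) 2 (complexBetti.map f₀ 2 (g M))
    rw [map_comp_apply', hgσ, map_add, map_tensorHom_map_fst, map_tensorHom_map_snd]
  -- the `K`-symmetrised class is `pr₁^* η + pr₂^* κ`
  have hh : (d : ℂ) • complexBetti.map ((f₀ ⊗ₘ f₀) ≫ segreEmbedding M M ℂ : (E.prod E).X ⟶ _) 2 (g (M * M + M + M)) +
      complexBetti.map
        (AbelianVariety.prodLift (AbelianVariety.snd E E ≫ (-((d : ℤ) • 𝟙 E))) (AbelianVariety.fst E E)).hom.hom.hom 2
        (complexBetti.map ((f₀ ⊗ₘ f₀) ≫ segreEmbedding M M ℂ : (E.prod E).X ⟶ _) 2 (g (M * M + M + M))) =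
      complexBetti.map f 2 (((d : ℂ) + 1) • θ₀) + complexBetti.map gm 2 (((d : ℂ) + (d : ℂ) ^ 2) • θ₀) := by
    rw [hθ, map_add, map_companion_map_fst, map_companion_map_snd, map_neg_zsmul_id_two, map_smul,
      map_smul, map_smul, smul_add]
    module
  -- a non-zero rational class of `H¹(E)` and its cup square
  obtain ⟨ℓ, hℓr, hℓ0⟩ := exists_isRationalClass_ne_zero_one E hE
  have hQ : ∀ η' : complexBetti E.X 2, Motives.polarizationPairingOne E.X η' 0 ℓ ℓ = 0 := fun η' ↦ by
    rw [Motives.polarizationPairingOne_apply, cupProduct_self_one, map_zero]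
  -- the frame `pr₁^* ℓ, pr₂^* ℓ`
  set U : Fin 1 ⊕ Fin 1 → complexBetti (E.prod E).X 1 :=
    Sum.elim (fun _ => complexBetti.map f 1 ℓ) (fun _ => complexBetti.map gm 1 ℓ) with hU
  let e : Fin 1 ⊕ Fin 1 ≃ Fin (2 * 1) := finSumFinEquiv.trans (finCongr (by norm_num))
  have hrange : Set.range (U ∘ e.symm) = Set.range U := e.symm.surjective.range_comp U
  have hm : 2 * 1 - 1 = 0 + 0 + 1 := by norm_num
  have key : IsHyperbolicWeilType (E.prod E)
      (AbelianVariety.prodLift (AbelianVariety.snd E E ≫ (-((d : ℤ) • 𝟙 E))) (AbelianVariety.fst E E)) 1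
      (complexBetti.map f 2 (((d : ℂ) + 1) • θ₀) + complexBetti.map gm 2 (((d : ℂ) + (d : ℂ) ^ 2) • θ₀)) := by
    refine ⟨U ∘ e.symm, fun i => ?_, ?_, fun i => ?_, fun i j => ?_⟩
    · -- rationality
      rcases hx : e.symm i with a | b
      · change IsRationalClass (U (e.symm i)); rw [hx]; exact hℓr.map _
      · change IsRationalClass (U (e.symm i)); rw [hx]; exact hℓr.map _
    · -- `ℂ`-independence (Künneth in degree one)
      have hu1 : LinearIndependent ℂ (fun _ : Fin 1 => ℓ) := linearIndependent_unique_iff.2 hℓ0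
      exact (linearIndependent_sumElim_map_fst_map_snd hu1 hu1).comp e.symm e.symm.injective
    · -- stability under `ψ^*`
      rw [hrange]
      change complexBetti.map _ 1 (U (e.symm i)) ∈ _
      rcases e.symm i with a | b
      · simp only [hU, Sum.elim_inl]
        rw [map_companion_map_fst, map_neg_zsmul_id_one, map_smul]
        exact Submodule.smul_mem _ _ (Submodule.subset_span ⟨Sum.inr 0, rfl⟩)
      · simp only [hU, Sum.elim_inr]
        rw [map_companion_map_snd]
        exact Submodule.subset_span ⟨Sum.inl 0, rfl⟩
    · -- isotropy: the block Gram matrix vanishes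
      change Motives.polarizationPairingOne _ _ _ (U (e.symm i)) (U (e.symm j)) = 0
      rcases e.symm i with a | b <;> rcases e.symm j with a' | b'
      · simp only [hU, Sum.elim_inl]
        rw [polarizationPairingOne_add_map_map f gm hX hX _ _ hm, hQ, map_zero, LinearMap.map_zero₂, smul_zero]
      · simp only [hU, Sum.elim_inl, Sum.elim_inr]
        exact polarizationPairingOne_add_map_map_mixed f gm hX hX _ _ hm ℓ ℓ
      · simp only [hU, Sum.elim_inl, Sum.elim_inr]
        exact polarizationPairingOne_add_map_map_mixed' f gm hX hX _ _ hm ℓ ℓ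
      · simp only [hU, Sum.elim_inr]
        rw [polarizationPairingOne_add_map_map' f gm hX hX _ _ hm, hQ, map_zero, map_zero, smul_zero]
  convert key using 1

end Summit.HodgeConjecture.HodgeConjecture.Theorems.HyperbolicEightfoldsSqrtMinus7.HyperbolicReach

end
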